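import Literature.NumberTheory.EllipticCurves.ModThreeCongruenceFlexTransport
import Literature.AlgebraicGeometry.PlaneCurves.WeierstrassNineFlexes
import HarnessLib

/-!
# Mod-`3` congruences of elliptic curves by a projective-linear transport of flexes, II:
# bijectivity, Galois equivariance, the congruence `W'[3] ≃ W[3]`, and the certificate form
# (the syzygetic pencil: Fisher, *The Hessian of a genus one curve*, Thm. 8.2 / Thm. 13.2;
# Artebani–Dolgachev, *The Hesse pencil of plane cubic curves*, §§2–3)

Topic `Literature/NumberTheory/EllipticCurves`, namespace
`Literature.NumberTheory.EllipticCurves.FlexTransport`. Part II of two files; Part I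
(`ModThreeCongruenceFlexTransport`) defines the datum `Datum`, the map `transport` and the hypothesis
`IsFlexTransport`, and proves that the transport is odd, injective and additive on `E'[3]`. Everything
here is PROVED (no named fact); the only `def`s are the bundled homomorphism / isomorphism.

## What is proved

Let `W, W'` be elliptic curves over a field `F` (Weierstrass cubics), `3 ≠ 0` in `F`, and let
`M = !![m₁₁, 0, m₁₃; m₂₁, m₂₂, m₂₃; m₃₁, 0, m₃₃]` be a matrix over `F` fixing the point
`O = (0 : 1 : 0)` (`m₂₂ ≠ 0`, `m₁₁m₃₃ − m₁₃m₃₁ ≠ 0`), acting on the affine chart by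
`(x, y) ↦ (u, v) = ((m₁₁x + m₁₃)/(m₃₁x + m₃₃), (m₂₁x + m₂₂y + m₂₃)/(m₃₁x + m₃₃))`.
**Hypothesis (the certificate `IsFlexTransport`)**: for every point `(x, y)` of `W'` over `F̄` with
`Ψ₃^{W'}(x) = 0` — these are exactly the affine points of order `3`, i.e. the eight affine flexes
(tree: `addOrderOf_eq_three_iff_Ψ₃_eval_eq_zero`, Silverman–Tate Thm. 2.1 (c)) — the denominator
`m₃₁x + m₃₃` is non-zero, `(u, v)` lies on `W`, and `Ψ₃^{W}(u) = 0`.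
**Conclusion (`exists_addEquiv_geomTorsion_three`)**: there is an additive isomorphism
`W'[3] ≃+ W[3]` of the geometric `3`-torsion groups (the tree's `WeierstrassCurve.geomTorsion`,
`GaloisAction`) commuting with the action of `Gal(F̄/F)`; for `F = ℚ` this is VERBATIM the body of the
Summits-side abbreviation `O6.ModPCongruent W' W 3` (`Rank1Residual/O6/X4CongruenceAnchor`), so a
road obtains `ModPCongruent W' W 3` from this theorem by `exact`.

The map is `O ↦ O`, `(x, y) ↦ (u, v)` (`transport`). Proof: (i) it lands in `W[3]` by the
hypothesis and the flex criterion; (ii) it is odd, `M(−P) = −M(P)`, because `M` maps the vertical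
line through `P` and `O` to the vertical line through `M(P)` and `O` (`transport_neg`); (iii) it is
ADDITIVE (`transport_add`): for `P, Q ∈ W'[3]` with distinct abscissae, `P, Q, R = −(P + Q)` are the
three intersections of their chord with `W'` (Mathlib's chord–tangent law), hence collinear; `M` is
linear, so `M(P), M(Q), M(R)` are collinear affine flexes of `W`, and by the secant theorem on `W`
(tree `eval_weierstrass_secant_eq_zero_iff`: a chord meets the cubic exactly in `U₁, U₂, −(U₁+U₂)`,
Silverman *AEC* III.2.3) `M(R) = −(M(P) + M(Q))`; the cases `Q = ±P` follow from (ii) and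
`2P = −P`; (iv) it is injective (a Möbius map in `x`, affine in `y`), hence BIJECTIVE because
`#W'[3] = #W[3] = 9` over `F̄` (tree `card_torsionBy_three`, Silverman–Tate Thm. 2.1 (d));
(v) it is Galois-equivariant because `M` has entries in `F` (`transport_smul`).

## Why such an `M` exists (context; not used in the proofs)

The elliptic curves DIRECTLY (= symplectically) `3`-congruent to `E` over `F` are exactly the curves
`F`-isomorphic to a non-singular member `λU + μH(U)` of the pencil spanned by the Weierstrass cubic `U`
of `E` and its Hessian [cite: Fisher2012Hessian, Thm. 8.2 ("the pencil spanned by U and H has the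
same Heisenberg group") and Thm. 13.2 (n = 3: "E' is directly n-congruent to E if and only if it is
isomorphic over K to E_{λ,μ}"; "in the case n = 3 the Hesse polynomials were already known to
Salmon")]; every smooth member passes through the nine base points = the nine flexes of `E` = `E[3]`,
with the same collinearity relations, hence the same group law on them [cite: ArtebaniDolgachev2009,
§2–§3 (the Hesse pencil and the Hesse configuration of its nine base points)]. An `F`-isomorphism of
the Weierstrass cubic `W'` with such a member sending `O` to `O` is projective-linear (both are
embedded by `|3·O|`), i.e. a matrix `M` as above; conversely an `M` carrying `W'[3]` onto `W[3]` maps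
`W'` into the pencil of cubics through `W[3]`, so it exists iff the congruence is direct. REVERSE
(anti-symplectic) `3`-congruences [cite: Fisher2012Hessian, §13 (Definition 13.1, X_E^-(n))] are not
of this form and are outside this file. Families with constant mod-`3` representation:
[cite: RubinSilverberg1995].

## Use (certificates)

`IsFlexTransport.of_baseChange` spells the hypothesis out in coordinates for base changes `L ⊇ F`:
three polynomial identities in `x, y` — in practice ideal-membership certificates modulo
`(Ψ₃^{W'}(x), W'(x, y))` with cofactors of degree `≤ 3`, closed by `linear_combination` — so that for
explicit curves over `ℚ` a mod-`3` congruence becomes a kernel-checked statement (seven integers `M`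
and three tiny identities, found numerically and verified exactly by computer algebra).

## Main declarations

* `Datum`, `Datum.u`, `Datum.v`, `Datum.den`, `Datum.map`; `Datum.u_injective`, `Datum.v_injective`,
  `Datum.collinear_transport` (a linear map preserves collinearity, in these coordinates).
* `three_zsmul_some_eq_zero_iff` (`3P = O ↔ Ψ₃(x) = 0`), `transport`, `IsFlexTransport`.
* `IsFlexTransport.transport_neg`, `.transport_injective`, **`.transport_add`**, `.torsionHom`,
  `.torsionHom_bijective`, `.torsionEquiv`.
* `transport_smul` (Galois equivariance), **`exists_addEquiv_geomTorsion_three`** (main theorem),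
  `IsFlexTransport.of_baseChange` (certificate form).

## References

* [Fisher2012Hessian] T. Fisher, *The Hessian of a genus one curve*, Proc. LMS (3) 104 (2012)
  613–648 (arXiv:math/0610403), Thm. 8.2, Lemma 8.3, Thm. 13.2, Def. 13.1 [held: paper:arxiv-math_0610403,
  pp. 12, 19].
* [ArtebaniDolgachev2009] M. Artebani, I. Dolgachev, *The Hesse pencil of plane cubic curves*,
  Enseign. Math. 55 (2009) 235–273, §§2–3.
* [RubinSilverberg1995] K. Rubin, A. Silverberg, *Families of elliptic curves with constant mod p
  representations* (1995).
* [SilvermanTate2015] J. H. Silverman, J. Tate, *Rational Points on Elliptic Curves*, 2nd ed., §2.1,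
  Thm. 2.1 (c), (d).
* [SilvermanAEC2009] J. H. Silverman, *The Arithmetic of Elliptic Curves*, 2nd ed., III.2,
  Group Law Algorithm 2.3; III.§7 (the Galois module `E[m]`).
-/

set_option autoImplicit false

noncomputable section

open scoped Classical

universe u

namespace Literature.NumberTheory.EllipticCurves.FlexTransport

open WeierstrassCurve Literature.AlgebraicGeometry.PlaneCurves

section Transport

variable {K : Type u} [Field K] {E E' : WeierstrassCurve K} {c : Datum K}

namespace IsFlexTransport

variable [E.IsElliptic] (hc : IsFlexTransport E E' c)
include hc

/-! ## §3. The induced isomorphism of the `3`-torsion groups -/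

/-- The transport restricted to the `3`-torsion subgroups is a homomorphism
`E'[3] →+ E[3]`. [cite: Fisher2012Hessian, §13, Thm. 13.2 (n = 3)] -/
def torsionHom : AddSubgroup.torsionBy E'.toAffine.Point 3 →+ AddSubgroup.torsionBy E.toAffine.Point 3 where
  toFun P := ⟨transport E E' c P, mem_torsionBy_iff.2 (hc.three_zsmul_transport_eq_zero (mem_torsionBy_iff.1 P.2))⟩
  map_zero' := Subtype.ext (transport_zero E E' c)
  map_add' P Q := Subtype.ext (hc.transport_add (mem_torsionBy_iff.1 P.2) (mem_torsionBy_iff.1 Q.2))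

/-- The underlying point of `torsionHom P` is the transport of `P`. [cite: Fisher2012Hessian, §13, Thm. 13.2 (n = 3)] -/
@[simp] theorem coe_torsionHom_apply (P : AddSubgroup.torsionBy E'.toAffine.Point 3) :
    ((hc.torsionHom P : AddSubgroup.torsionBy E.toAffine.Point 3) : E.toAffine.Point) =
      transport E E' c P := rfl

/-- `torsionHom` is injective. [cite: Fisher2012Hessian, §13, Thm. 13.2 (n = 3)] -/
theorem torsionHom_injective : Function.Injective hc.torsionHom := by
  intro P Q h
  apply Subtype.ext
  exact hc.transport_injective (mem_torsionBy_iff.1 P.2) (mem_torsionBy_iff.1 Q.2)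
    (congrArg Subtype.val h)

variable [E'.IsElliptic]

/-- **Bijectivity**: over an algebraically closed field with `3 ≠ 0`, both `E[3]` and `E'[3]` have
nine elements (tree `card_torsionBy_three`, Silverman–Tate Thm. 2.1 (d)), so the injective transport is
a bijection `E'[3] ≃ E[3]`. [cite: SilvermanTate2015, §2.1, Thm. 2.1 (d)] -/
theorem torsionHom_bijective [IsAlgClosed K] (h3 : (3 : K) ≠ 0) :
    Function.Bijective hc.torsionHom := by
  have hE : Nat.card (AddSubgroup.torsionBy E.toAffine.Point 3) = 9 := card_torsionBy_three E h3
  have hE' : Nat.card (AddSubgroup.torsionBy E'.toAffine.Point 3) = 9 := card_torsionBy_three E' h3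
  haveI : Finite (AddSubgroup.torsionBy E.toAffine.Point 3) := Nat.finite_of_card_ne_zero (by omega)
  exact hc.torsionHom_injective.bijective_of_nat_card_le (by omega)

/-- The transport as an isomorphism `E'[3] ≃+ E[3]` (algebraically closed field, `3 ≠ 0`).
[cite: Fisher2012Hessian, §13, Thm. 13.2 (n = 3)] [cite: SilvermanTate2015, §2.1, Thm. 2.1 (d)] -/
def torsionEquiv [IsAlgClosed K] (h3 : (3 : K) ≠ 0) :
    AddSubgroup.torsionBy E'.toAffine.Point 3 ≃+ AddSubgroup.torsionBy E.toAffine.Point 3 :=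
  AddEquiv.ofBijective hc.torsionHom (hc.torsionHom_bijective h3)

/-- The underlying point of `torsionEquiv P` is the transport of `P`. [cite: Fisher2012Hessian, §13, Thm. 13.2 (n = 3)] -/
@[simp] theorem coe_torsionEquiv_apply [IsAlgClosed K] (h3 : (3 : K) ≠ 0)
    (P : AddSubgroup.torsionBy E'.toAffine.Point 3) :
    ((hc.torsionEquiv h3 P : AddSubgroup.torsionBy E.toAffine.Point 3) : E.toAffine.Point) =
      transport E E' c P := rfl

end IsFlexTransport

end Transport

/-! ## §4. Curves over a field `F`: Galois equivariance and the mod-`3` congruence -/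

section Galois

variable {F : Type u} [Field F] (c₀ : Datum F)

/-- A datum with entries in `F` commutes with every `F`-automorphism of an extension `L`
(the transport is defined over `F`). [cite: Fisher2012Hessian, §13, Thm. 13.2 (n = 3)] -/
theorem Datum.algEquiv_u {L : Type u} [Field L] [Algebra F L] (σ : L ≃ₐ[F] L) (x : L) :
    σ ((c₀.map (algebraMap F L)).u x) = (c₀.map (algebraMap F L)).u (σ x) := by
  simp [Datum.u, Datum.den, Datum.map, map_div₀]

/-- The ordinate `v` of a datum over `F` commutes with `F`-automorphisms. [cite: Fisher2012Hessian, §13, Thm. 13.2 (n = 3)] -/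
theorem Datum.algEquiv_v {L : Type u} [Field L] [Algebra F L] (σ : L ≃ₐ[F] L) (x y : L) :
    σ ((c₀.map (algebraMap F L)).v x y) = (c₀.map (algebraMap F L)).v (σ x) (σ y) := by
  simp [Datum.v, Datum.den, Datum.map, map_div₀]

variable (W W' : WeierstrassCurve F) [W.IsElliptic]

/-- **Galois equivariance**: for curves and a datum defined over `F`, the transport on
`E'(L)[3] → E(L)[3]` commutes with `Aut(L/F)` (acting on coordinates, the tree's `σ • P`,
`GaloisAction`). [cite: Fisher2012Hessian, §13, Thm. 13.2 (n = 3)] [cite: SilvermanAEC2009, III.§7 (the Galois module E[m])] -/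
theorem transport_smul {L : Type u} [Field L] [Algebra F L]
    (hc : IsFlexTransport (W.baseChange L) (W'.baseChange L) (c₀.map (algebraMap F L)))
    (σ : L ≃ₐ[F] L) {P : (W'.baseChange L).toAffine.Point} (hP : (3 : ℤ) • P = 0) :
    transport (W.baseChange L) (W'.baseChange L) (c₀.map (algebraMap F L)) (σ • P) =
      σ • transport (W.baseChange L) (W'.baseChange L) (c₀.map (algebraMap F L)) P := by
  rcases P with _ | ⟨x, y, h⟩
  · rw [← WeierstrassCurve.Affine.Point.zero_def, smul_zero, transport_zero, smul_zero]
  · have hP' : (3 : ℤ) • WeierstrassCurve.Affine.Point.map (σ : L →ₐ[F] L) (WeierstrassCurve.Affine.Point.some x y h) = 0 := by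
      rw [← WeierstrassCurve.smul_def, smul_comm, hP, smul_zero]
    rw [WeierstrassCurve.Affine.Point.map_some] at hP'
    rw [WeierstrassCurve.smul_def, WeierstrassCurve.Affine.Point.map_some, hc.transport_eq _ hP', hc.transport_eq h hP,
      WeierstrassCurve.smul_def, WeierstrassCurve.Affine.Point.map_some, WeierstrassCurve.Affine.Point.some.injEq]
    exact ⟨(c₀.algEquiv_u σ x).symm, (c₀.algEquiv_v σ x y).symm⟩

/-- **Mod-`3` congruence by transport of flexes.** Let `W, W'` be elliptic curves over a field `F`
with `3 ≠ 0`, and let `M = !![m₁₁, 0, m₁₃; m₂₁, m₂₂, m₂₃; m₃₁, 0, m₃₃]` (entries in `F`,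
`m₂₂ ≠ 0`, `m₁₁m₃₃ − m₁₃m₃₁ ≠ 0`) carry every affine flex of `W'` over `F̄` — the points `(x, y)` of
`W'` with `Ψ₃^{W'}(x) = 0`, i.e. `W'[3] ∖ {O}` — to an affine flex `(u, v)` of `W`
(`u = (m₁₁x + m₁₃)/(m₃₁x + m₃₃)`, `v = (m₂₁x + m₂₂y + m₂₃)/(m₃₁x + m₃₃)`, `W(u, v) = 0`,
`Ψ₃^{W}(u) = 0`). Then `P ↦ M·P` is a `Gal(F̄/F)`-equivariant isomorphism `W'[3] ≃ W[3]` of the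
geometric `3`-torsion (the tree's `geomTorsion`, `GaloisAction`): **`W` and `W'` are `3`-congruent**.
This is the elementary content of the syzygetic (Hesse) pencil: the elliptic curves directly
`3`-congruent to `E` are exactly the members `λU + μH(U)` of the pencil spanned by the cubic `U` of
`E` and its Hessian, up to `F`-isomorphism [cite: Fisher2012Hessian, Thm. 8.2 and Thm. 13.2 (n = 3;
"in the case n = 3 the Hesse polynomials were already known to Salmon")], all of which pass
through the nine flexes of `E` [cite: ArtebaniDolgachev2009, §2–§3 (the Hesse configuration of the
nine base points = inflection points of every smooth member)]; a projective equivalence of `W'` with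
such a member, fixing `O`, is a matrix `M` as above, and conversely. Additivity: collinear flexes
sum to `O` (chord–tangent law) and `M` preserves lines; bijectivity: `#E[3] = 9`
[cite: SilvermanTate2015, §2.1, Thm. 2.1 (c), (d)]. -/
theorem exists_addEquiv_geomTorsion_three [W'.IsElliptic] (h3 : (3 : F) ≠ 0)
    (hc : IsFlexTransport (W.baseChange (AlgebraicClosure F)) (W'.baseChange (AlgebraicClosure F))
      (c₀.map (algebraMap F (AlgebraicClosure F)))) :
    ∃ e : W'.geomTorsion 3 ≃+ W.geomTorsion 3,
      ∀ (σ : Field.absoluteGaloisGroup F) (P : W'.geomTorsion 3), e (σ • P) = σ • e P := by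
  have h3K : (3 : AlgebraicClosure F) ≠ 0 := by
    rw [← map_ofNat (algebraMap F (AlgebraicClosure F)) 3]
    exact (map_ne_zero (algebraMap F (AlgebraicClosure F))).mpr h3
  refine ⟨hc.torsionEquiv h3K, fun σ P => ?_⟩
  apply Subtype.ext
  rw [AddSubgroup.torsionBy.coe_smul]
  change transport _ _ _ ((σ • P : W'.geomTorsion 3) : W'.geomPoints) =
    (show AlgebraicClosure F ≃ₐ[F] AlgebraicClosure F from σ) • transport _ _ _ (P : W'.geomPoints)
  rw [AddSubgroup.torsionBy.coe_smul]
  exact transport_smul c₀ W W' hc (show AlgebraicClosure F ≃ₐ[F] AlgebraicClosure F from σ)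
    (mem_torsionBy_iff.1 P.2)

end Galois


/-! ## §5. The certificate in coordinates (the form produced by computer algebra) -/

section Certificate

variable {F : Type u} [Field F] {L : Type u} [Field L] [Algebra F L]

/-- **The certificate, spelled out.** To verify `IsFlexTransport` for the base changes to `L ⊇ F` of
two curves `W, W'` over `F` and a datum over `F` it suffices to check, for all `x, y ∈ L` on `W'` with
`Ψ₃^{W'}(x) = 3x⁴ + b₂x³ + 3b₄x² + 3b₆x + b₈ = 0`: (i) `Z = m₃₁x + m₃₃ ≠ 0`, (ii) the homogeneous
Weierstrass cubic of `W` vanishes at `(X, Y, Z) = M(x, y, 1)`, (iii) the homogenised `Ψ₃^{W}`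
vanishes at `(X, Z)`. In practice (i)–(iii) are three ideal-membership identities in `F[x, y]`
modulo `(Ψ₃^{W'}(x), W'(x, y))`, checked by `linear_combination`. [cite: Fisher2012Hessian, §13, Thm. 13.2 (n = 3)] [cite: ArtebaniDolgachev2009, §2 (base points = flexes of each member)] -/
theorem IsFlexTransport.of_baseChange (W W' : WeierstrassCurve F) (c₀ : Datum F)
    (h22 : c₀.m₂₂ ≠ 0) (hdet : c₀.m₁₁ * c₀.m₃₃ - c₀.m₁₃ * c₀.m₃₁ ≠ 0)
    (hcert : ∀ x y : L,
      y ^ 2 + algebraMap F L W'.a₁ * x * y + algebraMap F L W'.a₃ * y =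
        x ^ 3 + algebraMap F L W'.a₂ * x ^ 2 + algebraMap F L W'.a₄ * x + algebraMap F L W'.a₆ →
      3 * x ^ 4 + algebraMap F L W'.b₂ * x ^ 3 + 3 * algebraMap F L W'.b₄ * x ^ 2 +
        3 * algebraMap F L W'.b₆ * x + algebraMap F L W'.b₈ = 0 →
      algebraMap F L c₀.m₃₁ * x + algebraMap F L c₀.m₃₃ ≠ 0 ∧
      (algebraMap F L c₀.m₂₁ * x + algebraMap F L c₀.m₂₂ * y + algebraMap F L c₀.m₂₃) ^ 2 *
            (algebraMap F L c₀.m₃₁ * x + algebraMap F L c₀.m₃₃) +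
          algebraMap F L W.a₁ * (algebraMap F L c₀.m₁₁ * x + algebraMap F L c₀.m₁₃) *
            (algebraMap F L c₀.m₂₁ * x + algebraMap F L c₀.m₂₂ * y + algebraMap F L c₀.m₂₃) *
            (algebraMap F L c₀.m₃₁ * x + algebraMap F L c₀.m₃₃) +
          algebraMap F L W.a₃ * (algebraMap F L c₀.m₂₁ * x + algebraMap F L c₀.m₂₂ * y +
            algebraMap F L c₀.m₂₃) * (algebraMap F L c₀.m₃₁ * x + algebraMap F L c₀.m₃₃) ^ 2 =
        (algebraMap F L c₀.m₁₁ * x + algebraMap F L c₀.m₁₃) ^ 3 +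
          algebraMap F L W.a₂ * (algebraMap F L c₀.m₁₁ * x + algebraMap F L c₀.m₁₃) ^ 2 *
            (algebraMap F L c₀.m₃₁ * x + algebraMap F L c₀.m₃₃) +
          algebraMap F L W.a₄ * (algebraMap F L c₀.m₁₁ * x + algebraMap F L c₀.m₁₃) *
            (algebraMap F L c₀.m₃₁ * x + algebraMap F L c₀.m₃₃) ^ 2 +
          algebraMap F L W.a₆ * (algebraMap F L c₀.m₃₁ * x + algebraMap F L c₀.m₃₃) ^ 3 ∧
      3 * (algebraMap F L c₀.m₁₁ * x + algebraMap F L c₀.m₁₃) ^ 4 +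
          algebraMap F L W.b₂ * (algebraMap F L c₀.m₁₁ * x + algebraMap F L c₀.m₁₃) ^ 3 *
            (algebraMap F L c₀.m₃₁ * x + algebraMap F L c₀.m₃₃) +
          3 * algebraMap F L W.b₄ * (algebraMap F L c₀.m₁₁ * x + algebraMap F L c₀.m₁₃) ^ 2 *
            (algebraMap F L c₀.m₃₁ * x + algebraMap F L c₀.m₃₃) ^ 2 +
          3 * algebraMap F L W.b₆ * (algebraMap F L c₀.m₁₁ * x + algebraMap F L c₀.m₁₃) *
            (algebraMap F L c₀.m₃₁ * x + algebraMap F L c₀.m₃₃) ^ 3 +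
          algebraMap F L W.b₈ * (algebraMap F L c₀.m₃₁ * x + algebraMap F L c₀.m₃₃) ^ 4 = 0) :
    IsFlexTransport (W.baseChange L) (W'.baseChange L) (c₀.map (algebraMap F L)) where
  m₂₂_ne_zero := by simpa [Datum.map] using h22
  det_ne_zero := by
    simpa [Datum.map, map_sub, map_mul] using (map_ne_zero (algebraMap F L)).mpr hdet
  cert x y hE hΨ := by
    have hE' := hE
    rw [WeierstrassCurve.Affine.equation_iff] at hE'
    simp only [WeierstrassCurve.baseChange, WeierstrassCurve.map_a₁, WeierstrassCurve.map_a₂,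
      WeierstrassCurve.map_a₃, WeierstrassCurve.map_a₄, WeierstrassCurve.map_a₆] at hE'
    have hΨ' := hΨ
    simp only [WeierstrassCurve.baseChange, WeierstrassCurve.Ψ₃, WeierstrassCurve.map_b₂,
      WeierstrassCurve.map_b₄, WeierstrassCurve.map_b₆, WeierstrassCurve.map_b₈, Polynomial.eval_add,
      Polynomial.eval_mul, Polynomial.eval_pow, Polynomial.eval_C, Polynomial.eval_X,
      Polynomial.eval_ofNat] at hΨ'
    obtain ⟨hZ, hF, hQ⟩ := hcert x y hE' hΨ'
    set X := algebraMap F L c₀.m₁₁ * x + algebraMap F L c₀.m₁₃ with hX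
    set Y := algebraMap F L c₀.m₂₁ * x + algebraMap F L c₀.m₂₂ * y + algebraMap F L c₀.m₂₃ with hY
    set Z := algebraMap F L c₀.m₃₁ * x + algebraMap F L c₀.m₃₃ with hZdef
    have hden : (c₀.map (algebraMap F L)).den x = Z := by simp [Datum.den, Datum.map, hZdef]
    have hu : (c₀.map (algebraMap F L)).u x = X / Z := by simp [Datum.u, Datum.den, Datum.map, hX, hZdef]
    have hv : (c₀.map (algebraMap F L)).v x y = Y / Z := by
      simp [Datum.v, Datum.den, Datum.map, hY, hZdef]
    refine ⟨by rwa [hden], ?_, ?_⟩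
    · rw [hu, hv, WeierstrassCurve.Affine.equation_iff]
      simp only [WeierstrassCurve.baseChange, WeierstrassCurve.map_a₁, WeierstrassCurve.map_a₂,
        WeierstrassCurve.map_a₃, WeierstrassCurve.map_a₄, WeierstrassCurve.map_a₆]
      field_simp
      linear_combination hF
    · rw [hu]
      simp only [WeierstrassCurve.baseChange, WeierstrassCurve.Ψ₃, WeierstrassCurve.map_b₂,
        WeierstrassCurve.map_b₄, WeierstrassCurve.map_b₆, WeierstrassCurve.map_b₈, Polynomial.eval_add,
        Polynomial.eval_mul, Polynomial.eval_pow, Polynomial.eval_C, Polynomial.eval_X,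
        Polynomial.eval_ofNat]
      field_simp
      linear_combination hQ

end Certificate

end Literature.NumberTheory.EllipticCurves.FlexTransport
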